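import Summits.QuantumFields.BalabanUV.T4Continuum.Support.NE3QbarNearFlat
import Summits.QuantumFields.BalabanUV.T4Continuum.Support.NE3TangentCovariantTower
import Summits.QuantumFields.BalabanUV.T4Continuum.Support.NE3CovariantLineSumsError
import Literature.MathematicalPhysics.QuantumFieldTheory.Balaban1983to89.B7Prop4Flat
import HarnessLib

/-!
# T⁴ programme, node NE3 — route Π, row Π-R (curved step), file Π-R-W4b: THE TOWER AT A NEAR-IDENTITY BACKGROUND —
# `‖QbarIter L (k+1) W Y c κ − linQIter L F (k+1) c κ‖ ≤ L^{k+1}·e + L^k·ŝ·Σ_{i≤k} ((2d+4)L²·δ_i + (8L + C_sup)·loopRad(x_i))`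

NE3 (node U1b) formalisation swarm, leaf seat `b2b-balaban-t4-ne3-formalise-leaf-01` (gen 8); FINDING F-ne3leaf01g8-1, re-planned row Π-R-W (`HOME/CLAIMS.log`
2026-08-20 ≈23:04Z), file W4b — the (k+1)-fold iterate of W4a (`NE3QbarNearFlat.norm_Qbar_sub_linQ_le`).  In the multi-level small-field class
(`IsUnitaryCfg W`, `0 ≤ x`, `LevelSmall d L k x`, `SmallField W x`, `L ≥ 1`) fix a coarse site `c` and the ℓ¹-BALLS `B_m := {y : |y − L^m•c|₁ ≤ nbRad·Σ_{i<m} L^i}`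
around its images on the lower lattices (`B_{m+1} ⊇ L•B_m +` the one-level stencil `nbRad = 2dL + 2L`).  If (a) `‖(cavgIter L i W)(y,μ) − 1‖ ≤ δ_i` on
`B_{k+1−i}` for `i ≤ k`, (b) `‖QbarIter L i W Y (y,μ)‖ ≤ L^i·ŝ` there (`norm_QbarIter_le_two_mul`: `ŝ = 2s` from the level-0 sup, by leaf-04's `Ssum_le_one`),
(c) `‖Y − F‖ ≤ e` on `B_{k+1}`, then **`‖QbarIter L (k+1) W Y c κ − linQIter L F (k+1) c κ‖ ≤ L^{k+1}e + L^k ŝ·Σ_{i<k+1}((2d+4)L²δ_i + (8L + C_sup)·loopRad d L (x_i))`**,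
`x_i = (prop1Radius d L)^[i] x` (`norm_QbarIter_sub_linQIter_le`) — the EXACT solution of `e_{i+1} = ρ_i·L^iŝ + L·e_i` by the inner-first induction of the
tower; B7's `linQIter` has the matching inner form (`linQIter_succ_inner`, `B7Prop4Flat.linQ_comp`).  No factor `k` (the sums are geometric; W4c bounds them).
CONTENT ([folklore]; 0 sorry; 0 def): §1 ball bookkeeping + `linQIter_succ_inner`; §2 the three ONE-STEP lemmas on balls; §3 the sup tower
`norm_QbarIter_le_prod` (exact product), the near-identity tower `norm_cavgIter_sub_one_le_tower` (exact solution), **`norm_QbarIter_sub_linQIter_le`**;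
§4 `prod_one_add_le` and the `2s` corollary.
HONEST FRAMING.  Kinematics of OUR linearised averaging tower at one background; nothing about minimisers; (P♮)_W, T-E_w and **NE3 are NOT proved**;
spine PROVED 0∕9; finite T⁴ rung (B)+1 — NOT infinite volume, NOT mass gap, NOT `BetaPertH`, NOT Clay.  PLACEMENT: `Summits/QuantumFields/BalabanUV/`.
HONEST DEPENDENCY (cell page 1): continuum YM on T⁴ ⇐ BetaPertH ∧ nine spine estimates (0/9 proved); BetaPertH ⇐ (D1) ∧ (D4) ∧ CAP+tail; G-an2-4 gates
asym, D1 and NE2/3/4.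
-/

set_option autoImplicit false

open scoped BigOperators Matrix.Norms.L2Operator
open Finset

namespace Summit.QuantumFields.BalabanUV.T4Continuum.NE3QbarIterNearFlat

open Literature.MathematicalPhysics.QuantumFieldTheory.Balaban1983to89
open B7Prop1Explicit B7Prop2Explicit
open T4AveragingDeficitWall (IsUnitaryCfg IsSkewDir SmallField Ad)
open AveragingDeficitTransport (norm_Ad_of_unitary mem_U1_of_unitary)
open AveragingDeficitNearIdentity (norm_hol_sub_one_le_of_bonds)
open AveragingDeficitLocality (bondsOf l1_le_of_mem_bondsOf)
open AveragingDeficitChartCalculus (cavg)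
open AveragingDeficitMultiLevelPrep (cavgIter LevelSmall prop1Radius_nonneg)
open AveragingDeficitTwoLevelPrep (prop1Radius)
open AveragingDeficitBlockDensity (bseg cavg_mem)
open SpreadLift (loopRad loopRad_le loopBound_of_smallField)
open B7Prop3Flat (linQ norm_linQ_le)
open B7Prop4Flat (linQIter linQIter_eq_linQ_pow linQ_comp linQ_sub)
open BlockAverageVaryHolo (nbRad l1_sub_self)
open NE3NestedBlockMeanCovariance (norm_cavg_sub_bseg_le)
open NE3TangentCovariantStructure (Qbar)
open NE3TangentCovariantTower (QbarIter QbarIter_zero QbarIter_one step_small)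
open NE3CovariantLineSumsError (Csup wC Csup_nonneg wC_nonneg)
open NE3QbarNearFlat (norm_Qbar_le_sup norm_Qbar_sub_linQ_le)

noncomputable section

variable {d : ℕ} {n : Type*} [Fintype n] [DecidableEq n]

/-! ## §1 Ball bookkeeping and the inner form of `linQIter` -/

/-- `|L•y − L•b|₁ = L·|y − b|₁`. [folklore] -/
theorem l1_smul_sub (L : ℕ) (y b : Site d) : l1 ((L : ℤ) • y - (L : ℤ) • b) = L * l1 (y - b) := by
  rw [← smul_sub]; unfold l1; rw [Finset.mul_sum]; exact Finset.sum_congr rfl fun ι _ => by simp [Int.natAbs_mul]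

/-- THE BALL STEP: a point of the one-level reading stencil about `L•y`, `y` in the ball of radius `R` about `b`, lies in the ball of radius
`nbRad + L·R` about `L•b`. [folklore] -/
theorem ball_step {L R : ℕ} {b y x' : Site d} (hy : l1 (y - b) ≤ R) (hx : l1 (x' - (L : ℤ) • y) ≤ nbRad d L) :
    l1 (x' - (L : ℤ) • b) ≤ nbRad d L + L * R := by
  have h := l1_add_le (x' - (L : ℤ) • y) ((L : ℤ) • y - (L : ℤ) • b)
  rw [show x' - (L : ℤ) • y + ((L : ℤ) • y - (L : ℤ) • b) = x' - (L : ℤ) • b by abel, l1_smul_sub] at h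
  have h2 : L * l1 (y - b) ≤ L * R := Nat.mul_le_mul_left _ hy
  omega

/-- The ball radii: `nbRad·Σ_{i<m+1} L^i = nbRad + L·(nbRad·Σ_{i<m} L^i)`. [folklore] -/
theorem rad_succ (d L m : ℕ) :
    nbRad d L * ∑ i ∈ Finset.range (m + 1), L ^ i = nbRad d L + L * (nbRad d L * ∑ i ∈ Finset.range m, L ^ i) := by
  rw [Finset.sum_range_succ', pow_zero, mul_add, mul_one, add_comm, Finset.mul_sum, Finset.mul_sum, Finset.mul_sum]
  congr 1; exact Finset.sum_congr rfl fun i _ => by ring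

/-- `L^{m+1}•c = L•(L^m•c)`. [folklore] -/
theorem pow_succ_smul (L m : ℕ) (c : Site d) : ((L : ℤ) ^ (m + 1)) • c = (L : ℤ) • (((L : ℤ) ^ m) • c) := by rw [smul_smul, pow_succ']

/-- **THE INNER FORM OF THE ITERATED STRAIGHT-LINE AVERAGE**: `linQIter L F (m+1) = linQIter L (linQ L F ∘ L•) m` (both are the `L^{m+1}`-block
average, `B7Prop4Flat.linQIter_eq_linQ_pow` ∕ `linQ_comp`). [cite: Balaban1985Averaging, p.39] -/
theorem linQIter_succ_inner (L : ℕ) (F : Site d → Fin d → Matrix n n ℂ) (m : ℕ) (z : Site d) (κ : Fin d) :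
    linQIter L F (m + 1) z κ = linQIter L (fun z' κ' => linQ L F ((L : ℤ) • z') κ') m z κ := by
  rw [linQIter_eq_linQ_pow, linQIter_eq_linQ_pow, linQ_comp, smul_smul, ← pow_succ]
  congr 2; push_cast; ring

/-! ## §2 The three one-step lemmas on balls -/

section OneStep

variable [Nonempty n] {L : ℕ} (hL : 1 ≤ L) {W : Site d → Fin d → (Matrix n n ℂ)ˣ} (hWu : IsUnitaryCfg W) {a : ℝ} (ha : 0 ≤ a)
  (h512 : 512 * (d + 1) * (d + 4) * (L : ℝ) ^ 2 * a ≤ 1) (hWa : SmallField W a)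

include hL hWu ha h512 hWa in
/-- **ONE STEP, NEAR-IDENTITY**: if `‖W(b′) − 1‖ ≤ δ` on the ball of radius `nbRad + L·R` about `L•b`, then `‖(cavg L W)(y,μ) − 1‖ ≤ L·δ + 4·loopRad`
on the ball of radius `R` about `b` (NE3-R2's `norm_cavg_sub_bseg_le` + telescoping along `Γ_c`). [folklore] -/
theorem norm_cavg_sub_one_le_ball {R : ℕ} {b : Site d} {δ : ℝ}
    (hW : ∀ (x' : Site d) (μ : Fin d), l1 (x' - (L : ℤ) • b) ≤ nbRad d L + L * R → ‖((W x' μ : (Matrix n n ℂ)ˣ) : Matrix n n ℂ) - 1‖ ≤ δ)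
    (y : Site d) (μ : Fin d) (hy : l1 (y - b) ≤ R) :
    ‖((cavg L W y μ : (Matrix n n ℂ)ˣ) : Matrix n n ℂ) - 1‖ ≤ L * δ + 4 * loopRad d L a := by
  have hsg : ‖((bseg L W y μ : (Matrix n n ℂ)ˣ) : Matrix n n ℂ) - 1‖ ≤ L * δ := by
    unfold bseg
    have h := norm_hol_sub_one_le_of_bonds hWu ((L : ℤ) • y) (seg μ (L : ℤ)) fun c hc => hW c.1 c.2 (by
      have := l1_le_of_mem_bondsOf _ _ c hc
      rw [length_seg, Int.natAbs_natCast] at this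
      exact ball_step hy (by rw [nbRad]; omega))
    rwa [length_seg, Int.natAbs_natCast] at h
  have hcb := norm_cavg_sub_bseg_le hL hWu ha h512 hWa y μ
  calc ‖((cavg L W y μ : (Matrix n n ℂ)ˣ) : Matrix n n ℂ) - 1‖
      = ‖(((cavg L W y μ : (Matrix n n ℂ)ˣ) : Matrix n n ℂ) - bseg L W y μ) + (((bseg L W y μ : (Matrix n n ℂ)ˣ) : Matrix n n ℂ) - 1)‖ := by
        rw [sub_add_sub_cancel]
    _ ≤ 4 * loopRad d L a + L * δ := (norm_add_le _ _).trans (add_le_add hcb hsg)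
    _ = L * δ + 4 * loopRad d L a := by ring

include hL hWu ha h512 hWa in
/-- **ONE STEP, SUP**: if `‖Y(b′)‖ ≤ s` on the ball of radius `nbRad + L·R` about `L•b`, then `‖Qbar L W Y (y,μ)‖ ≤ (L + wC d L a)·s` on the ball of
radius `R` about `b` (W4a `norm_Qbar_le_sup`; `wC = loopRad·C_sup`). [folklore] -/
theorem norm_Qbar_le_ball {R : ℕ} {b : Site d} (Y : Site d → Fin d → Matrix n n ℂ) {s : ℝ}
    (hY : ∀ (x' : Site d) (μ : Fin d), l1 (x' - (L : ℤ) • b) ≤ nbRad d L + L * R → ‖Y x' μ‖ ≤ s)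
    (y : Site d) (μ : Fin d) (hy : l1 (y - b) ≤ R) : ‖Qbar L W Y y μ‖ ≤ ((L : ℝ) + wC d L a) * s := by
  have h := norm_Qbar_le_sup hL hWu ha h512 hWa y μ Y fun x' ν hx' => hY x' ν (ball_step hy hx')
  have hwC : wC d L a = loopRad d L a * (1250 * ((nbRad d L : ℝ) + L) + 8 * (d * L) + 2 * L) := by
    unfold wC loopRad Csup; ring
  rw [hwC]; exact h

include hL hWu ha h512 hWa in
/-- **ONE STEP, ERROR**: if on the ball of radius `nbRad + L·R` about `L•b` the bonds of `W` are within `δ` of `1`, `‖Y‖ ≤ s` and `‖Y − F‖ ≤ e`,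
then on the ball of radius `R` about `b`,
`‖Qbar L W Y (y,μ) − linQ L F (L•y) μ‖ ≤ ((2d+4)L²·δ + (8L + C_sup)·loopRad)·s + L·e` (W4a + linearity of `linQ`). [folklore] -/
theorem norm_Qbar_sub_linQ_le_ball {R : ℕ} {b : Site d} {δ : ℝ}
    (hW : ∀ (x' : Site d) (μ : Fin d), l1 (x' - (L : ℤ) • b) ≤ nbRad d L + L * R → ‖((W x' μ : (Matrix n n ℂ)ˣ) : Matrix n n ℂ) - 1‖ ≤ δ)
    (Y F : Site d → Fin d → Matrix n n ℂ) {s e : ℝ}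
    (hY : ∀ (x' : Site d) (μ : Fin d), l1 (x' - (L : ℤ) • b) ≤ nbRad d L + L * R → ‖Y x' μ‖ ≤ s)
    (hYF : ∀ (x' : Site d) (μ : Fin d), l1 (x' - (L : ℤ) • b) ≤ nbRad d L + L * R → ‖Y x' μ - F x' μ‖ ≤ e)
    (y : Site d) (μ : Fin d) (hy : l1 (y - b) ≤ R) :
    ‖Qbar L W Y y μ - linQ L F ((L : ℤ) • y) μ‖
      ≤ ((2 * (d : ℝ) + 4) * (L : ℝ) ^ 2 * δ + (8 * (L : ℝ) + Csup d L) * loopRad d L a) * s + L * e := by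
  have hδ0 : 0 ≤ δ := (norm_nonneg _).trans (hW ((L : ℤ) • y) μ (ball_step hy (by rw [l1_sub_self]; exact Nat.zero_le _)))
  have he0 : 0 ≤ e := (norm_nonneg _).trans (hYF ((L : ℤ) • y) μ (ball_step hy (by rw [l1_sub_self]; exact Nat.zero_le _)))
  have h1 := norm_Qbar_sub_linQ_le hL hWu ha h512 hWa y μ hδ0 (fun x' ν hx' => hW x' ν (ball_step hy hx')) Y
    (fun x' ν hx' => hY x' ν (ball_step hy hx'))
  have h2 : ‖linQ L Y ((L : ℤ) • y) μ - linQ L F ((L : ℤ) • y) μ‖ ≤ L * e := by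
    rw [← linQ_sub]
    exact norm_linQ_le (Y - F) ((L : ℤ) • y) (nbRad d L) he0 (fun x' ν hx' => hYF x' ν (ball_step hy hx')) L hL _ μ
      (by rw [l1_sub_self, nbRad]; omega)
  have hC : Csup d L = 1250 * ((nbRad d L : ℝ) + L) + 8 * (d * L) + 2 * L := rfl
  calc ‖Qbar L W Y y μ - linQ L F ((L : ℤ) • y) μ‖
      = ‖(Qbar L W Y y μ - linQ L Y ((L : ℤ) • y) μ) + (linQ L Y ((L : ℤ) • y) μ - linQ L F ((L : ℤ) • y) μ)‖ := by rw [sub_add_sub_cancel]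
    _ ≤ _ := (norm_add_le _ _).trans (add_le_add h1 h2)
    _ = _ := by rw [hC]

end OneStep

/-! ## §3 The towers -/

section Tower

variable [Nonempty n] {L : ℕ} (hL : 1 ≤ L)

include hL in
/-- **THE SUP TOWER (exact product form)**: in the class, if `‖Y‖ ≤ s` on the fine ball `B_{k+1}`, then for `i + m = k + 1`,
`‖QbarIter L i W Y (y,μ)‖ ≤ s·Π_{i'<i} (L + wC d L (x_{i'}))` on `B_m` (`x_{i'} = (prop1Radius)^[i'] x`). [folklore] -/
theorem norm_QbarIter_le_prod (k : ℕ) :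
    ∀ {W : Site d → Fin d → (Matrix n n ℂ)ˣ} {x : ℝ}, IsUnitaryCfg W → 0 ≤ x → LevelSmall d L k x → SmallField W x →
    ∀ (Y : Site d → Fin d → Matrix n n ℂ) (c : Site d) {s : ℝ},
    (∀ (x' : Site d) (μ : Fin d), l1 (x' - ((L : ℤ) ^ (k + 1)) • c) ≤ nbRad d L * ∑ i ∈ Finset.range (k + 1), L ^ i → ‖Y x' μ‖ ≤ s) →
    ∀ (i m : ℕ), i + m = k + 1 → ∀ (y : Site d) (μ : Fin d), l1 (y - ((L : ℤ) ^ m) • c) ≤ nbRad d L * ∑ i ∈ Finset.range m, L ^ i →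
      ‖QbarIter L i W Y y μ‖ ≤ s * ∏ i' ∈ Finset.range i, ((L : ℝ) + wC d L ((prop1Radius d L)^[i'] x)) := by
  induction k with
  | zero =>
      intro W x hWu hx hs hWx Y c s hY i m him y μ hy
      obtain ⟨h512, -, -, -⟩ := step_small hL hWu hx hs hWx
      rcases i with _ | i
      · -- level 0
        have hm : m = 1 := by omega
        subst hm
        simp only [Finset.range_zero, Finset.prod_empty, mul_one]
        exact hY y μ (by simpa using hy)
      · have hm : m = 0 := by omega
        have hi : i = 0 := by omega
        subst hm hi
        simp only [zero_add, Finset.range_one, Finset.prod_singleton, Function.iterate_zero, id_eq]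
        rw [mul_comm]
        refine norm_Qbar_le_ball hL hWu hx h512 hWx Y (R := 0) (b := c) (fun x' ν hx' => hY x' ν ?_) y μ (by simpa using hy)
        simpa using hx'
  | succ k ih =>
      intro W x hWu hx hs hWx Y c s hY i m him y μ hy
      obtain ⟨h512, hW₁u, hr0, hW₁x⟩ := step_small hL hWu hx hs.1 hWx
      rcases i with _ | i
      · have hm : m = k + 2 := by omega
        subst hm
        simp only [Finset.range_zero, Finset.prod_empty, mul_one]
        exact hY y μ hy
      · -- `QbarIter L (i+1) W Y = QbarIter L i (cavg L W) (Qbar L W Y)`; the induction hypothesis one level up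
        have hY₁ : ∀ (x' : Site d) (μ : Fin d), l1 (x' - ((L : ℤ) ^ (k + 1)) • c) ≤ nbRad d L * ∑ i ∈ Finset.range (k + 1), L ^ i →
            ‖Qbar L W Y x' μ‖ ≤ ((L : ℝ) + wC d L x) * s := fun x' ν hx' =>
          norm_Qbar_le_ball hL hWu hx h512 hWx Y (fun x'' ν' hx'' => hY x'' ν' (by rw [pow_succ_smul, rad_succ]; exact hx'')) x' ν hx'
        have h := ih hW₁u hr0 hs.2 hW₁x (Qbar L W Y) c hY₁ i m (by omega) y μ hy
        show ‖QbarIter L i (cavg L W) (Qbar L W Y) y μ‖ ≤ _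
        refine h.trans (le_of_eq ?_)
        rw [Finset.prod_range_succ' (fun i' => (L : ℝ) + wC d L ((prop1Radius d L)^[i'] x))]
        simp only [Function.iterate_succ_apply, Function.iterate_zero, id_eq]
        ring

include hL in
/-- **THE NEAR-IDENTITY TOWER (exact solution)**: in the class, if `‖W − 1‖ ≤ δ` on the fine ball `B_{k+1}`, then for `i + m = k + 1`,
`‖(cavgIter L i W)(y,μ) − 1‖ ≤ L^i·δ + 4·Σ_{i'<i} L^{i−1−i'}·loopRad d L (x_{i'})` on `B_m`. [folklore] -/
theorem norm_cavgIter_sub_one_le_tower (k : ℕ) :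
    ∀ {W : Site d → Fin d → (Matrix n n ℂ)ˣ} {x : ℝ}, IsUnitaryCfg W → 0 ≤ x → LevelSmall d L k x → SmallField W x →
    ∀ (c : Site d) {δ : ℝ},
    (∀ (x' : Site d) (μ : Fin d), l1 (x' - ((L : ℤ) ^ (k + 1)) • c) ≤ nbRad d L * ∑ i ∈ Finset.range (k + 1), L ^ i →
      ‖((W x' μ : (Matrix n n ℂ)ˣ) : Matrix n n ℂ) - 1‖ ≤ δ) →
    ∀ (i m : ℕ), i + m = k + 1 → ∀ (y : Site d) (μ : Fin d), l1 (y - ((L : ℤ) ^ m) • c) ≤ nbRad d L * ∑ i ∈ Finset.range m, L ^ i →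
      ‖((cavgIter L i W y μ : (Matrix n n ℂ)ˣ) : Matrix n n ℂ) - 1‖
        ≤ (L : ℝ) ^ i * δ + 4 * ∑ i' ∈ Finset.range i, (L : ℝ) ^ (i - 1 - i') * loopRad d L ((prop1Radius d L)^[i'] x) := by
  induction k with
  | zero =>
      intro W x hWu hx hs hWx c δ hW i m him y μ hy
      obtain ⟨h512, -, -, -⟩ := step_small hL hWu hx hs hWx
      rcases i with _ | i
      · have hm : m = 1 := by omega
        subst hm
        simp only [pow_zero, one_mul, Finset.range_zero, Finset.sum_empty, mul_zero, add_zero]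
        exact hW y μ (by simpa using hy)
      · have hm : m = 0 := by omega
        have hi : i = 0 := by omega
        subst hm hi
        simp only [zero_add, pow_one, Finset.range_one, Finset.sum_singleton, Nat.sub_self, pow_zero, one_mul,
          Function.iterate_zero, id_eq]
        refine norm_cavg_sub_one_le_ball hL hWu hx h512 hWx (R := 0) (b := c) (fun x' ν hx' => hW x' ν ?_) y μ (by simpa using hy)
        simpa using hx'
  | succ k ih =>
      intro W x hWu hx hs hWx c δ hW i m him y μ hy
      obtain ⟨h512, hW₁u, hr0, hW₁x⟩ := step_small hL hWu hx hs.1 hWx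
      rcases i with _ | i
      · have hm : m = k + 2 := by omega
        subst hm
        simp only [pow_zero, one_mul, Finset.range_zero, Finset.sum_empty, mul_zero, add_zero]
        exact hW y μ hy
      · have hW₁ : ∀ (x' : Site d) (μ : Fin d), l1 (x' - ((L : ℤ) ^ (k + 1)) • c) ≤ nbRad d L * ∑ i ∈ Finset.range (k + 1), L ^ i →
            ‖((cavg L W x' μ : (Matrix n n ℂ)ˣ) : Matrix n n ℂ) - 1‖ ≤ L * δ + 4 * loopRad d L x := fun x' ν hx' =>
          norm_cavg_sub_one_le_ball hL hWu hx h512 hWx (fun x'' ν' hx'' => hW x'' ν' (by rw [pow_succ_smul, rad_succ]; exact hx'')) x' ν hx'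
        have h := ih hW₁u hr0 hs.2 hW₁x c hW₁ i m (by omega) y μ hy
        show ‖((cavgIter L i (cavg L W) y μ : (Matrix n n ℂ)ˣ) : Matrix n n ℂ) - 1‖ ≤ _
        refine h.trans (le_of_eq ?_)
        rw [Finset.sum_range_succ' (fun i' => (L : ℝ) ^ (i + 1 - 1 - i') * loopRad d L ((prop1Radius d L)^[i'] x))]
        simp only [Function.iterate_succ_apply, Function.iterate_zero, id_eq, Nat.add_sub_cancel, Nat.sub_zero]
        have hre : ∀ i' ∈ Finset.range i, (L : ℝ) ^ (i - 1 - i') * loopRad d L ((prop1Radius d L)^[i'] (prop1Radius d L x))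
            = (L : ℝ) ^ (i - (i' + 1)) * loopRad d L ((prop1Radius d L)^[i'] (prop1Radius d L x)) := by
          intro i' _; congr 2; omega
        rw [Finset.sum_congr rfl hre, mul_add, pow_succ]
        ring

include hL in
/-- **THE ERROR TOWER (exact solution of the linear recursion)**: in the multi-level small-field class, with (a) the near-identity family `δ_i`
of the averaged backgrounds on the balls, (b) the sup family `L^i·ŝ` of the iterated readings, (c) `‖Y − F‖ ≤ e` on the fine ball,
`‖QbarIter L (k+1) W Y c κ − linQIter L F (k+1) c κ‖ ≤ L^{k+1}·e + L^k·ŝ·Σ_{i<k+1} ((2d+4)L²·δ_i + (8L + C_sup)·loopRad d L (x_i))`. [folklore] -/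
theorem norm_QbarIter_sub_linQIter_le (k : ℕ) :
    ∀ {W : Site d → Fin d → (Matrix n n ℂ)ˣ} {x : ℝ}, IsUnitaryCfg W → 0 ≤ x → LevelSmall d L k x → SmallField W x →
    ∀ (Y F : Site d → Fin d → Matrix n n ℂ) (c : Site d) (κ : Fin d) {ŝ e : ℝ} (δf : ℕ → ℝ),
    (∀ (i m : ℕ), i + m = k → ∀ (y : Site d) (μ : Fin d), l1 (y - ((L : ℤ) ^ (m + 1)) • c) ≤ nbRad d L * ∑ i ∈ Finset.range (m + 1), L ^ i →
      ‖((cavgIter L i W y μ : (Matrix n n ℂ)ˣ) : Matrix n n ℂ) - 1‖ ≤ δf i) →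
    (∀ (i m : ℕ), i + m = k → ∀ (y : Site d) (μ : Fin d), l1 (y - ((L : ℤ) ^ (m + 1)) • c) ≤ nbRad d L * ∑ i ∈ Finset.range (m + 1), L ^ i →
      ‖QbarIter L i W Y y μ‖ ≤ (L : ℝ) ^ i * ŝ) →
    (∀ (y : Site d) (μ : Fin d), l1 (y - ((L : ℤ) ^ (k + 1)) • c) ≤ nbRad d L * ∑ i ∈ Finset.range (k + 1), L ^ i → ‖Y y μ - F y μ‖ ≤ e) →
      ‖QbarIter L (k + 1) W Y c κ - linQIter L F (k + 1) c κ‖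
        ≤ (L : ℝ) ^ (k + 1) * e + (L : ℝ) ^ k * ŝ * ∑ i ∈ Finset.range (k + 1),
            ((2 * (d : ℝ) + 4) * (L : ℝ) ^ 2 * δf i + (8 * (L : ℝ) + Csup d L) * loopRad d L ((prop1Radius d L)^[i] x)) := by
  induction k with
  | zero =>
      intro W x hWu hx hs hWx Y F c κ ŝ e δf ha hb hc
      obtain ⟨h512, -, -, -⟩ := step_small hL hWu hx hs hWx
      have e1 : ((L : ℤ) ^ (0 + 1)) • c = (L : ℤ) • c := by rw [zero_add, pow_one]
      have e2 : nbRad d L * ∑ i ∈ Finset.range (0 + 1), L ^ i = nbRad d L + L * 0 := by simp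
      have ha0 : ∀ (x' : Site d) (μ : Fin d), l1 (x' - (L : ℤ) • c) ≤ nbRad d L + L * 0 →
          ‖((W x' μ : (Matrix n n ℂ)ˣ) : Matrix n n ℂ) - 1‖ ≤ δf 0 := fun x' ν hx' => by
        have := ha 0 0 rfl x' ν (by rw [e1, e2]; exact hx')
        exact this
      have hb0 : ∀ (x' : Site d) (μ : Fin d), l1 (x' - (L : ℤ) • c) ≤ nbRad d L + L * 0 → ‖Y x' μ‖ ≤ ŝ := fun x' ν hx' => by
        have := hb 0 0 rfl x' ν (by rw [e1, e2]; exact hx')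
        rw [QbarIter_zero, pow_zero, one_mul] at this
        exact this
      have hc0 : ∀ (x' : Site d) (μ : Fin d), l1 (x' - (L : ℤ) • c) ≤ nbRad d L + L * 0 → ‖Y x' μ - F x' μ‖ ≤ e :=
        fun x' ν hx' => hc x' ν (by rw [e1, e2]; exact hx')
      -- one step with `R = 0`
      have h := norm_Qbar_sub_linQ_le_ball hL hWu hx h512 hWx (R := 0) (b := c) ha0 Y F hb0 hc0 c κ (by rw [l1_sub_self])
      rw [zero_add, QbarIter_one, B7Prop4Flat.linQIter_succ, B7Prop4Flat.linQIter_zero]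
      simp only [pow_one, Finset.range_one, Finset.sum_singleton, pow_zero, one_mul, Function.iterate_zero, id_eq]
      linarith
  | succ k ih =>
      intro W x hWu hx hs hWx Y F c κ ŝ e δf ha hb hc
      obtain ⟨h512, hW₁u, hr0, hW₁x⟩ := step_small hL hWu hx hs.1 hWx
      set ρ₀ : ℝ := (2 * (d : ℝ) + 4) * (L : ℝ) ^ 2 * δf 0 + (8 * (L : ℝ) + Csup d L) * loopRad d L x with hρ₀
      -- the level-1 data
      have ha₁ : ∀ (i m : ℕ), i + m = k → ∀ (y : Site d) (μ : Fin d),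
          l1 (y - ((L : ℤ) ^ (m + 1)) • c) ≤ nbRad d L * ∑ i ∈ Finset.range (m + 1), L ^ i →
          ‖((cavgIter L i (cavg L W) y μ : (Matrix n n ℂ)ˣ) : Matrix n n ℂ) - 1‖ ≤ δf (i + 1) :=
        fun i m him y μ hy => ha (i + 1) m (by omega) y μ hy
      have hb₁ : ∀ (i m : ℕ), i + m = k → ∀ (y : Site d) (μ : Fin d),
          l1 (y - ((L : ℤ) ^ (m + 1)) • c) ≤ nbRad d L * ∑ i ∈ Finset.range (m + 1), L ^ i →
          ‖QbarIter L i (cavg L W) (Qbar L W Y) y μ‖ ≤ (L : ℝ) ^ i * (L * ŝ) := by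
        intro i m him y μ hy
        have := hb (i + 1) m (by omega) y μ hy
        rw [pow_succ] at this
        show ‖QbarIter L (i + 1) W Y y μ‖ ≤ _
        linarith
      have hc₁ : ∀ (y : Site d) (μ : Fin d), l1 (y - ((L : ℤ) ^ (k + 1)) • c) ≤ nbRad d L * ∑ i ∈ Finset.range (k + 1), L ^ i →
          ‖Qbar L W Y y μ - linQ L F ((L : ℤ) • y) μ‖ ≤ ρ₀ * ŝ + L * e := by
        intro y μ hy
        have haW : ∀ (x' : Site d) (μ : Fin d), l1 (x' - (L : ℤ) • (((L : ℤ) ^ (k + 1)) • c)) ≤ nbRad d L + L * (nbRad d L * ∑ i ∈ Finset.range (k + 1), L ^ i) →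
            ‖((W x' μ : (Matrix n n ℂ)ˣ) : Matrix n n ℂ) - 1‖ ≤ δf 0 := fun x' ν hx' =>
          ha 0 (k + 1) (by omega) x' ν (by rw [pow_succ_smul, rad_succ]; exact hx')
        have hbY : ∀ (x' : Site d) (μ : Fin d), l1 (x' - (L : ℤ) • (((L : ℤ) ^ (k + 1)) • c)) ≤ nbRad d L + L * (nbRad d L * ∑ i ∈ Finset.range (k + 1), L ^ i) →
            ‖Y x' μ‖ ≤ ŝ := fun x' ν hx' => by
          have := hb 0 (k + 1) (by omega) x' ν (by rw [pow_succ_smul, rad_succ]; exact hx')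
          rw [QbarIter_zero, pow_zero, one_mul] at this
          exact this
        have hcY : ∀ (x' : Site d) (μ : Fin d), l1 (x' - (L : ℤ) • (((L : ℤ) ^ (k + 1)) • c)) ≤ nbRad d L + L * (nbRad d L * ∑ i ∈ Finset.range (k + 1), L ^ i) →
            ‖Y x' μ - F x' μ‖ ≤ e := fun x' ν hx' => hc x' ν (by rw [pow_succ_smul, rad_succ]; exact hx')
        exact norm_Qbar_sub_linQ_le_ball hL hWu hx h512 hWx haW Y F hbY hcY y μ hy
      have h := ih hW₁u hr0 hs.2 hW₁x (Qbar L W Y) (fun z' κ' => linQ L F ((L : ℤ) • z') κ') c κ (fun i => δf (i + 1)) ha₁ hb₁ hc₁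
      rw [show QbarIter L (k + 1 + 1) W Y c κ = QbarIter L (k + 1) (cavg L W) (Qbar L W Y) c κ from rfl, linQIter_succ_inner]
      refine h.trans (le_of_eq ?_)
      rw [Finset.sum_range_succ' (fun i => (2 * (d : ℝ) + 4) * (L : ℝ) ^ 2 * δf i
        + (8 * (L : ℝ) + Csup d L) * loopRad d L ((prop1Radius d L)^[i] x))]
      simp only [Function.iterate_succ_apply, Function.iterate_zero, id_eq, hρ₀]
      ring

end Tower

/-! ## §4 The product of the one-level factors and the `2s` corollary -/

/-- `Π_{i<m} (1 + a_i) ≤ 1 + 2·Σ_{i<m} a_i` for `a_i ≥ 0` with `Σ_{i<m} a_i ≤ 1∕2`. [folklore] -/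
theorem prod_one_add_le (a : ℕ → ℝ) (ha : ∀ i, 0 ≤ a i) :
    ∀ m : ℕ, (∑ i ∈ Finset.range m, a i) ≤ 1 / 2 → ∏ i ∈ Finset.range m, (1 + a i) ≤ 1 + 2 * ∑ i ∈ Finset.range m, a i
  | 0, _ => by simp
  | m + 1, h => by
      rw [Finset.sum_range_succ] at h ⊢
      rw [Finset.prod_range_succ]
      have hA : (∑ i ∈ Finset.range m, a i) ≤ 1 / 2 := by linarith [ha m]
      have ih := prod_one_add_le a ha m hA
      have hP0 : 0 ≤ ∏ i ∈ Finset.range m, (1 + a i) := Finset.prod_nonneg fun i _ => by linarith [ha i]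
      have hA0 : 0 ≤ ∑ i ∈ Finset.range m, a i := Finset.sum_nonneg fun i _ => ha i
      nlinarith [ha m, mul_le_mul_of_nonneg_right ih (by linarith [ha m] : (0 : ℝ) ≤ 1 + a m)]

/-- `Π_{i<m} (L + w_i) ≤ 2·L^m` for `w_i ≥ 0` with `Σ_{i<m} w_i ≤ L∕2` (`L ≥ 1`). [folklore] -/
theorem prod_add_le_two_mul_pow {L : ℕ} (hL : 1 ≤ L) (w : ℕ → ℝ) (hw : ∀ i, 0 ≤ w i) (m : ℕ)
    (h : (∑ i ∈ Finset.range m, w i) ≤ (L : ℝ) / 2) : ∏ i ∈ Finset.range m, ((L : ℝ) + w i) ≤ 2 * (L : ℝ) ^ m := by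
  have hL0 : (0 : ℝ) < L := by exact_mod_cast (by omega : 0 < L)
  rw [Finset.prod_congr rfl fun i _ => (show (L : ℝ) + w i = L * (1 + w i / L) by field_simp), Finset.prod_mul_distrib,
    Finset.prod_const, Finset.card_range]
  have hsum : (∑ i ∈ Finset.range m, w i / L) ≤ 1 / 2 := by rw [← Finset.sum_div, div_le_iff₀ hL0]; linarith
  have hp := prod_one_add_le (fun i => w i / L) (fun i => div_nonneg (hw i) hL0.le) m hsum
  have hLm : (0 : ℝ) ≤ (L : ℝ) ^ m := by positivity
  calc (L : ℝ) ^ m * ∏ i ∈ Finset.range m, (1 + w i / L) ≤ (L : ℝ) ^ m * 2 :=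
        mul_le_mul_of_nonneg_left (hp.trans (by linarith)) hLm
    _ = 2 * (L : ℝ) ^ m := by ring

/-- `Σ_{i<m} wC(x_i) = Ssum d L m x` (leaf-04's inner-first level sum, unrolled). [folklore] -/
theorem sum_wC_eq_Ssum (d L : ℕ) : ∀ (m : ℕ) (x : ℝ),
    (∑ i ∈ Finset.range m, wC d L ((prop1Radius d L)^[i] x)) = NE3CovariantLineSumsError.Ssum d L m x
  | 0, _ => by simp [NE3CovariantLineSumsError.Ssum]
  | m + 1, x => by
      rw [Finset.sum_range_succ', NE3CovariantLineSumsError.Ssum_succ, ← sum_wC_eq_Ssum d L m (prop1Radius d L x)]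
      simp only [Function.iterate_succ_apply, Function.iterate_zero, id_eq]
      ring

/-- **THE SUP TOWER IN THE CLASS** (`L ≥ 2`): `‖QbarIter L i W Y (y,μ)‖ ≤ 2·L^i·s` on `B_m` (`i + m = k+1`) — leaf-04's `Ssum_le_one` makes
`Σ_{i<k+1} wC(x_i) ≤ 1 ≤ L∕2`. [folklore] -/
theorem norm_QbarIter_le_two_mul [Nonempty n] {L : ℕ} (hL : 2 ≤ L) (k : ℕ) {W : Site d → Fin d → (Matrix n n ℂ)ˣ} {x : ℝ}
    (hWu : IsUnitaryCfg W) (hx : 0 ≤ x) (hs : LevelSmall d L k x) (hWx : SmallField W x) (Y : Site d → Fin d → Matrix n n ℂ) (c : Site d)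
    {s : ℝ} (hs0 : 0 ≤ s)
    (hY : ∀ (x' : Site d) (μ : Fin d), l1 (x' - ((L : ℤ) ^ (k + 1)) • c) ≤ nbRad d L * ∑ i ∈ Finset.range (k + 1), L ^ i → ‖Y x' μ‖ ≤ s)
    (i m : ℕ) (him : i + m = k + 1) (y : Site d) (μ : Fin d) (hy : l1 (y - ((L : ℤ) ^ m) • c) ≤ nbRad d L * ∑ i ∈ Finset.range m, L ^ i) :
    ‖QbarIter L i W Y y μ‖ ≤ 2 * (L : ℝ) ^ i * s := by
  have h := norm_QbarIter_le_prod (by omega) k hWu hx hs hWx Y c hY i m him y μ hy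
  have hS : (∑ i' ∈ Finset.range i, wC d L ((prop1Radius d L)^[i'] x)) ≤ (L : ℝ) / 2 := by
    have hmono : (∑ i' ∈ Finset.range i, wC d L ((prop1Radius d L)^[i'] x)) ≤ ∑ i' ∈ Finset.range (k + 1), wC d L ((prop1Radius d L)^[i'] x) :=
      Finset.sum_le_sum_of_subset_of_nonneg (Finset.range_mono (by omega))
        fun i' _ _ => wC_nonneg d L (NE3CovariantLineSumsError.iterate_prop1Radius_nonneg (d := d) i' hx)
    have hfull : (∑ i' ∈ Finset.range (k + 1), wC d L ((prop1Radius d L)^[i'] x)) ≤ 1 := by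
      rw [sum_wC_eq_Ssum]
      obtain ⟨h1, h2⟩ := NE3CovariantLineSumsError.Ssum_le_one (d := d) hL hx hs
      exact h1.trans h2
    have hL2 : (2 : ℝ) ≤ L := by exact_mod_cast hL
    linarith
  have hp := prod_add_le_two_mul_pow (by omega) (fun i' => wC d L ((prop1Radius d L)^[i'] x))
    (fun i' => wC_nonneg d L (NE3CovariantLineSumsError.iterate_prop1Radius_nonneg (d := d) i' hx)) i hS
  calc ‖QbarIter L i W Y y μ‖ ≤ s * ∏ i' ∈ Finset.range i, ((L : ℝ) + wC d L ((prop1Radius d L)^[i'] x)) := h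
    _ ≤ s * (2 * (L : ℝ) ^ i) := mul_le_mul_of_nonneg_left hp hs0
    _ = 2 * (L : ℝ) ^ i * s := by ring

end

end Summit.QuantumFields.BalabanUV.T4Continuum.NE3QbarIterNearFlat
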